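import Summits.KontsevichZagierPeriods.KontsevichZagierPeriods.Theorems.TerasomaMultiplicationMultiplicationThreeStubLowerCellToNegativeBranchAux
import Summits.KontsevichZagierPeriods.KontsevichZagierPeriods.Theorems.TerasomaMultiplicationMultiplicationThreeStubLowerCellToNegativeBranchAux2

/-!
# `MultiplicationThree` (stmt-KontsevichZagierPeriods-3598), line `bolza-involution-real-quotient`:
# stub S2 — step (ii): the cube-root chart on the lower cell

Stub `stub_lowerCellToNegativeBranch` of the crux `MultiplicationThree` (route `TerasomaMultiplication`;
lead skeleton `Cruxes/MultiplicationThree/Lines/bolza-involution-real-quotient.lean`).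

On the lower cell `{0 < u, 0 < v, v < 1 − u, u < (1−v)²}` of the sheared box (`u = x 0`, `v = x 1`)
the density `u^{s−1}(ψ+ψ̄)/2`, `ψ = v^{−2/3}(1−v)^{−2/3}(1−u−v)^{−1/3}`,
`ψ̄ = v^{−1/3}(1−v)^{−1/3}(1−u−v)^{−2/3}`, is pushed forward along the cube-root chart of the idea
card `bolza-involution-real-quotient`, `Φ(u,v) = (u, a)`, `a = −(z−1)²/z`,
`z = (v(1−v)/(1−u−v))^{1/3}`, onto the negative branch `Σ_neg = {0 < u < 1, a < 0}` of the level
cubics `w² = Q(a,u) = a²(3−a)² − 4ua`. By the exact Bolza lever of the tree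
(`MultiplicationThreeNegative.bolza_lever`: `|∂a/∂v| = √Q·(ψ+ψ̄)/3`, packaged with the sign lemma as
`s2_det_chart`) the push-forward density is `(3/2)·u^{s−1}/√Q(a,u)`. The set-theoretic data (a
bijection `lowerCell → Σ_neg`, file `…Aux`) and the analytic data (derivative with `det = ∂a/∂v`,
semialgebraicity, file `…Aux2`) make this ONE instance of Kontsevich–Zagier's rule (2)
(`s2_chart_move`); the target representation EXISTS because absolute integrability is transported
through the chart (`integrableOn_image_iff_integrableOn_abs_det_fderiv_smul`, `s2_exists_target`).

Nothing is defined in this file: cells, chart and densities are written out.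

References: M. Kontsevich, D. Zagier, *Periods* (2001), §1.2 rule (2).
-/

noncomputable section

open Set MeasureTheory MvPolynomial
open Literature.NumberTheory.Transcendental Literature.NumberTheory.Transcendental.KZ
open Literature.ModelTheory.ExponentialFields (IsSemialgebraic)

namespace Summit.KontsevichZagierPeriods.TerasomaMultiplication.MultiplicationThreeBolza

open Summit.KontsevichZagierPeriods.TerasomaMultiplication.MultiplicationThreeNegative

/-- **The rule-(2) integrand relation of the chart.** On the lower cell, for the `v`-derivative `J`
of the slice of the chart, `u^{s−1}(ψ+ψ̄)/2 = (3/2)·(u^{s−1}/√Q(a,u))·|J|`. [folklore] -/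
theorem s2_density_relation (s : ℚ) {x : Fin 2 → ℝ} {J : ℝ} (hx : x ∈ {x : Fin 2 → ℝ | 0 < x 0 ∧ 0 < x 1 ∧ x 1 < 1 - x 0 ∧ x 0 < (1 - x 1) ^ 2})
    (hJ : HasDerivAt (fun t : ℝ => -((t * (1 - t) / (1 - x 0 - t)) ^ ((1:ℝ)/3) - 1) ^ 2 / (t * (1 - t) / (1 - x 0 - t)) ^ ((1:ℝ)/3)) J (x 1)) :
    (fun x : Fin 2 → ℝ => ((x 0) ^ ((s:ℝ) - 1) * ((x 1) ^ (-(2:ℝ)/3) * (1 - x 1) ^ (-(2:ℝ)/3) * (1 - x 0 - x 1) ^ (-(1:ℝ)/3)) + (x 0) ^ ((s:ℝ) - 1) * ((x 1) ^ (-(1:ℝ)/3) * (1 - x 1) ^ (-(1:ℝ)/3) * (1 - x 0 - x 1) ^ (-(2:ℝ)/3))) / 2) x = (fun x : Fin 2 → ℝ => 3 / 2 * ((x 0) ^ ((s:ℝ) - 1) / Real.sqrt ((x 1) ^ 2 * (3 - x 1) ^ 2 - 4 * x 0 * x 1))) ((fun y : Fin 2 → ℝ => (![y 0, -((y 1 *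 (1 - y 1) / (1 - y 0 - y 1)) ^ ((1:ℝ)/3) - 1) ^ 2 / (y 1 * (1 - y 1) / (1 - y 0 - y 1)) ^ ((1:ℝ)/3)] : Fin 2 → ℝ)) x) * |J| := by
  obtain ⟨hJ0, hQ, hJeq⟩ := s2_det_chart hx hJ
  obtain ⟨h0, h1, h2, -⟩ := hx
  have hN : 0 < 1 - x 0 - x 1 := by linarith
  have h1v : 0 < 1 - x 1 := by linarith
  rw [abs_of_pos hJ0, hJeq]
  simp only [Matrix.cons_val_zero, Matrix.cons_val_one]
  set a := -((x 1 * (1 - x 1) / (1 - x 0 - x 1)) ^ ((1:ℝ)/3) - 1) ^ 2 / (x 1 * (1 - x 1) / (1 - x 0 - x 1)) ^ ((1:ℝ)/3) with ha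
  set S := Real.sqrt (a ^ 2 * (3 - a) ^ 2 - 4 * x 0 * a) with hS
  set A := x 0 ^ ((s:ℝ) - 1) with hA
  set P := x 1 ^ (-(2:ℝ)/3) * (1 - x 1) ^ (-(2:ℝ)/3) * (1 - x 0 - x 1) ^ (-(1:ℝ)/3) with hP
  set P' := x 1 ^ (-(1:ℝ)/3) * (1 - x 1) ^ (-(1:ℝ)/3) * (1 - x 0 - x 1) ^ (-(2:ℝ)/3) with hP'
  have hS0 : S ≠ 0 := (Real.sqrt_pos.2 hQ).ne'
  field_simp

/-- **The target representation exists**: for any representation `r` of `u^{s−1}(ψ+ψ̄)/2` on the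
lower cell there is an integral representation with domain `Σ_neg` and integrand LITERALLY
`(3/2)·u^{s−1}/√Q(a,u)` — its absolute integrability is that of `r`, transported through the chart
(Jacobian formula), its semialgebraicity is that of an Euler–Mellin monomial. [folklore] -/
theorem s2_exists_target (s : ℚ) (r : IntegralRep 2) (hr : r.domain = {x : Fin 2 → ℝ | 0 < x 0 ∧ 0 < x 1 ∧ x 1 < 1 - x 0 ∧ x 0 < (1 - x 1) ^ 2})
    (hri : EqOn r.integrand (fun x : Fin 2 → ℝ => ((x 0) ^ ((s:ℝ) - 1) * ((x 1) ^ (-(2:ℝ)/3) * (1 - x 1) ^ (-(2:ℝ)/3) * (1 - x 0 - x 1) ^ (-(1:ℝ)/3)) + (x 0) ^ ((s:ℝ) - 1) * ((x 1) ^ (-(1:ℝ)/3) * (1 - x 1) ^ (-(1:ℝ)/3) * (1 - x 0 - x 1) ^ (-(2:ℝ)/3))) / 2) r.domain) :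
    ∃ ρ : IntegralRep 2, ρ.domain = {x : Fin 2 → ℝ | 0 < x 0 ∧ x 0 < 1 ∧ x 1 < 0} ∧ ρ.integrand = (fun x : Fin 2 → ℝ => 3 / 2 * ((x 0) ^ ((s:ℝ) - 1) / Real.sqrt ((x 1) ^ 2 * (3 - x 1) ^ 2 - 4 * x 0 * x 1))) := by
  obtain ⟨D, hD⟩ := s2_hasFDerivAt_chart
  have hSneg : IsSemialgebraic ℚ {x : Fin 2 → ℝ | 0 < x 0 ∧ x 0 < 1 ∧ x 1 < 0} := by
    convert isSemialgebraic_setOf_forall_aeval_pos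
      (![X 0, 1 - X 0, -X 1] : Fin 3 → MvPolynomial (Fin 2) ℚ) using 1
    ext x
    simp only [mem_setOf_eq, Fin.forall_fin_succ, Matrix.cons_val_zero, Matrix.cons_val_succ,
      map_sub, map_one, map_neg, MvPolynomial.aeval_X, IsEmpty.forall_iff, and_true]
    constructor
    · rintro ⟨h0, h1, h2⟩; exact ⟨h0, by linarith, by linarith⟩
    · rintro ⟨h0, h1, h2⟩; exact ⟨h0, by linarith, by linarith⟩
  have hmeas : MeasurableSet {x : Fin 2 → ℝ | 0 < x 0 ∧ 0 < x 1 ∧ x 1 < 1 - x 0 ∧ x 0 < (1 - x 1) ^ 2} :=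
    IsSemialgebraic.measurableSet_holds s2_isSemialgebraic_lowerCell
  have hderiv : ∀ x ∈ {x : Fin 2 → ℝ | 0 < x 0 ∧ 0 < x 1 ∧ x 1 < 1 - x 0 ∧ x 0 < (1 - x 1) ^ 2}, HasFDerivWithinAt (fun y : Fin 2 → ℝ => (![y 0, -((y 1 * (1 - y 1) / (1 - y 0 - y 1)) ^ ((1:ℝ)/3) - 1) ^ 2 / (y 1 * (1 - y 1) / (1 - y 0 - y 1)) ^ ((1:ℝ)/3)] : Fin 2 → ℝ)) (D x) {x : Fin 2 → ℝ | 0 < x 0 ∧ 0 < x 1 ∧ x 1 < 1 - x 0 ∧ x 0 < (1 - x 1) ^ 2} x := fun x hx =>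
    (hD x hx.1 hx.2.1 hx.2.2.1).1.hasFDerivWithinAt
  have hint : IntegrableOn (fun x : Fin 2 → ℝ => 3 / 2 * ((x 0) ^ ((s:ℝ) - 1) / Real.sqrt ((x 1) ^ 2 * (3 - x 1) ^ 2 - 4 * x 0 * x 1))) {x : Fin 2 → ℝ | 0 < x 0 ∧ x 0 < 1 ∧ x 1 < 0} := by
    rw [← s2_image_chart]
    refine (integrableOn_image_iff_integrableOn_abs_det_fderiv_smul volume hmeas hderiv
      s2_injOn_chart _).mpr ?_
    have hri' : IntegrableOn r.integrand {x : Fin 2 → ℝ | 0 < x 0 ∧ 0 < x 1 ∧ x 1 < 1 - x 0 ∧ x 0 < (1 - x 1) ^ 2} := hr ▸ r.integrableOn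
    refine hri'.congr_fun (fun x hx => ?_) hmeas
    rw [hri (hr ▸ hx), smul_eq_mul, mul_comm]
    exact s2_density_relation s hx (hD x hx.1 hx.2.1 hx.2.2.1).2
  exact ⟨⟨{x : Fin 2 → ℝ | 0 < x 0 ∧ x 0 < 1 ∧ x 1 < 0}, (fun x : Fin 2 → ℝ => 3 / 2 * ((x 0) ^ ((s:ℝ) - 1) / Real.sqrt ((x 1) ^ 2 * (3 - x 1) ^ 2 - 4 * x 0 * x 1))), hSneg, s2_isSemialgebraicFunOn_target s hSneg, hint⟩, rfl, rfl⟩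

/-- **The chart is ONE rule-(2) move**: for `r = [lowerCell, u^{s−1}(ψ+ψ̄)/2]` and
`ρ = [Σ_neg, (3/2)·u^{s−1}/√Q]`, `[r] − [ρ] ∈ changeOfVariablesRel` along `Φ` (a `ℚ`-semialgebraic map
with derivative within the cell, injective, `Φ '' lowerCell = Σ_neg`, integrand relation with `|det|`).
[folklore] -/
theorem s2_chart_move (s : ℚ) (r ρ : IntegralRep 2) (hr : r.domain = {x : Fin 2 → ℝ | 0 < x 0 ∧ 0 < x 1 ∧ x 1 < 1 - x 0 ∧ x 0 < (1 - x 1) ^ 2})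
    (hri : EqOn r.integrand (fun x : Fin 2 → ℝ => ((x 0) ^ ((s:ℝ) - 1) * ((x 1) ^ (-(2:ℝ)/3) * (1 - x 1) ^ (-(2:ℝ)/3) * (1 - x 0 - x 1) ^ (-(1:ℝ)/3)) + (x 0) ^ ((s:ℝ) - 1) * ((x 1) ^ (-(1:ℝ)/3) * (1 - x 1) ^ (-(1:ℝ)/3) * (1 - x 0 - x 1) ^ (-(2:ℝ)/3))) / 2) r.domain) (hρ : ρ.domain = {x : Fin 2 → ℝ | 0 < x 0 ∧ x 0 < 1 ∧ x 1 < 0})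
    (hρi : EqOn ρ.integrand (fun x : Fin 2 → ℝ => 3 / 2 * ((x 0) ^ ((s:ℝ) - 1) / Real.sqrt ((x 1) ^ 2 * (3 - x 1) ^ 2 - 4 * x 0 * x 1))) ρ.domain) : of r - of ρ ∈ changeOfVariablesRel := by
  obtain ⟨D, hD⟩ := s2_hasFDerivAt_chart
  refine ⟨2, r, ρ, (fun y : Fin 2 → ℝ => (![y 0, -((y 1 * (1 - y 1) / (1 - y 0 - y 1)) ^ ((1:ℝ)/3) - 1) ^ 2 / (y 1 * (1 - y 1) / (1 - y 0 - y 1)) ^ ((1:ℝ)/3)] : Fin 2 → ℝ)), D, ?_, fun x hx => ?_, ?_, ?_, fun x hx => ?_, rfl⟩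
  · rw [hr]; exact s2_isSemialgebraicMapOn_chart
  · rw [hr] at hx ⊢
    exact (hD x hx.1 hx.2.1 hx.2.2.1).1.hasFDerivWithinAt
  · rw [hr]; exact s2_injOn_chart
  · rw [hρ, hr, s2_image_chart]
  · have hx' : x ∈ {x : Fin 2 → ℝ | 0 < x 0 ∧ 0 < x 1 ∧ x 1 < 1 - x 0 ∧ x 0 < (1 - x 1) ^ 2} := hr ▸ hx
    have hmem : (fun y : Fin 2 → ℝ => (![y 0, -((y 1 * (1 - y 1) / (1 - y 0 - y 1)) ^ ((1:ℝ)/3) - 1) ^ 2 / (y 1 * (1 - y 1) / (1 - y 0 - y 1)) ^ ((1:ℝ)/3)] : Fin 2 → ℝ)) x ∈ ρ.domain := by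
      rw [hρ]; exact s2_mapsTo_chart hx'
    rw [hri hx, hρi hmem]
    exact s2_density_relation s hx' (hD x hx'.1 hx'.2.1 hx'.2.2.1).2

/-- **Stub S2.** `[lowerCell, u^{s−1}(ψ+ψ̄)/2] ~ [Σ_neg, (3/2)·u^{s−1}/√Q(a,u)]` by ONE change of
variables along the cube-root chart `Φ(u,v) = (u, −(z−1)²/z)`, `z = (v(1−v)/(1−u−v))^{1/3}` (rule (2)
of the Kontsevich–Zagier calculus), and a representation of the latter shape exists (integrability
transported through the chart). [folklore] -/
theorem stub_lowerCellToNegativeBranch :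
    ∀ s : ℚ, 0 < s → ∀ (r : Literature.NumberTheory.Transcendental.KZ.IntegralRep 2), r.domain = {x | 0 < x 0 ∧ 0 < x 1 ∧ x 1 < 1 - x 0 ∧ x 0 < (1 - x 1) ^ 2} → Set.EqOn r.integrand (fun x => ((x 0) ^ ((s:ℝ) - 1) * ((x 1) ^ (-(2:ℝ)/3) * (1 - x 1) ^ (-(2:ℝ)/3) * (1 - x 0 - x 1) ^ (-(1:ℝ)/3)) + (x 0) ^ ((s:ℝ) - 1) * ((x 1) ^ (-(1:ℝ)/3) * (1 - x 1) ^ (-(1:ℝ)/3) * (1 - x 0 - x 1) ^ (-(2:ℝ)/3))) / 2) r.domain → (∃ ρ : Literature.NumberTheory.Transcendental.KZ.IntegralRep 2, ρ.domain = {x | 0 < x 0 ∧ x 0 < 1 ∧ x 1 < 0} ∧ Set.EqOn ρ.integrand (fun x => 3 / 2 * ((x 0) ^ ((s:ℝ) - 1) / Real.sqrt ((x 1) ^ 2 * (3 - x 1) ^ 2 - 4 * x 0 * x 1))) ρ.domain) ∧ ∀ (ρ : Literature.NumberTheory.Transcendental.KZ.IntegralRep 2), ρ.domain = {x | 0 <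 x 0 ∧ x 0 < 1 ∧ x 1 < 0} → Set.EqOn ρ.integrand (fun x => 3 / 2 * ((x 0) ^ ((s:ℝ) - 1) / Real.sqrt ((x 1) ^ 2 * (3 - x 1) ^ 2 - 4 * x 0 * x 1))) ρ.domain → Literature.NumberTheory.Transcendental.KZ.Equivalent r ρ := by
  intro s _ r hr hri
  obtain ⟨ρ₀, hρ₀, hρ₀i⟩ := s2_exists_target s r hr hri
  refine ⟨⟨ρ₀, hρ₀, fun x _ => by rw [hρ₀i]⟩, fun ρ hρ hρi => ?_⟩
  exact changeOfVariablesRel_subset_relations (s2_chart_move s r ρ hr hri hρ hρi)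

end Summit.KontsevichZagierPeriods.TerasomaMultiplication.MultiplicationThreeBolza

end
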